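import Literature.Probability.Distributions.PoissonBinomialDifferences
import HarnessLib

/-!
# Exponential tilting of a Poisson-binomial law; the tilted law is modal at any prescribed point;
# POINTWISE RELATIVE bounds for even differences: `|∇^{2k} q(x+k)| ≤ q(x)·λ^{−k}·(…tilted ℓ¹ smoothness…)`

Measure-free facts about the law `q = PoissonBinomial.pmf ps` of a sum of independent Bernoulli variables
with parameters `p_1, …, p_N ∈ [0,1]` (Lange's table, `PoissonBinomialRecursion.lean`), continuing
`PoissonBinomialSmoothness.lean` (log-concavity, unimodality) and `PoissonBinomialDifferences.lean`
(`ℓ¹` bounds `‖∇^j q‖₁ ≤ (C j/V)^{j/2}`). The point of this file is to turn those ABSOLUTE (`ℓ¹`)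
smoothness bounds into POINTWISE RELATIVE ones — `|∇^{2k} q|` at a point compared with `q` AT THAT POINT,
also deep in the tails — by Cramér's exponential tilting [Durrett 2019, §2.7: the tilted distribution
`F_θ(dx) = e^{θx}F(dx)/φ(θ)`]:

* §1 **tilting** (`tilt`): the tilted parameters `p ↦ pλ/((1−p)+pλ)` (`λ > 0`) are again in `[0,1]`
  (`tilt_mem`), the normaliser `M(λ) = Π((1−p)+pλ) > 0` (`tiltNorm_pos`), and
  **`pmf_tilt_mul_tiltNorm`**: `pmf (tilt λ ps) k · M(λ) = λ^k · pmf ps k` — the tilted law of a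
  Poisson-binomial law is the Poisson-binomial law of the tilted parameters; `var_tilt_ge`:
  `V(tilt λ ps) ≥ min(λ, λ⁻¹)·V(ps)`.
* §2 **the tilted law is modal where you want** (`pmf_tilt_le_of_ratio`): for `λ = q(x)/q(x+1)`
  (`q(x), q(x+1) > 0`) the point `x` is a maximiser of `pmf (tilt λ ps)` — log-concavity
  (`isLogConcaveSeq_pmf`, ratio monotonicity) [Karlin 1968, Ch. 8 §1].
* §3 **the maximal atom is at least `3/(8(2√V+1))`** (`exists_max_pmf_ge`): Chebyshev's inequality
  [Durrett 2019, Thm. 1.6.4] plus pigeonhole on the `≤ 4√V+2` integers within `2√V + ½` of the mean.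
* §4 **sup from `ℓ¹` one order up** (`two_mul_abs_coeff_le_absCoeffSum_one_sub_X_mul`): for every real
  polynomial `R` with `R(1) = 0`… in general `2|R_n| ≤ ‖(1−X)R‖₁ + |R(1)|`; for `R = (1−X)^j G` (`j ≥ 1`)
  `2·|∇^j q(n)| ≤ ‖∇^{j+1} q‖₁` [Röllin–Ross 2015, §3 (Lemma 3.1: `D_n` as an `ℓ¹` norm)].
* §5 **the tilted difference identity** (`coeff_one_sub_X_pow_mul_eq_tilt`): with `q' = pmf (tilt λ ps)`,
  `∇^{m} q(n) · λ^{n} = M(λ) · Σ_{j ≤ m} C(m,j) (1−λ)^{m−j} ∇^j q'(n − m + j)` (terms with `m − j > n` absent)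
  — `(1 − λY)^{m} = Σ_j C(m,j)((1−λ)Y)^{m−j}(1−Y)^j` composed with `Y = X/λ`.
* §6 **THE POINTWISE RELATIVE BOUND** (`abs_nabla_even_le_mul_pmf`): for `ps ⊂ [0,1]`, `q(x), q(x+1) > 0`,
  `λ = q(x)/q(x+1)`, `q' = pmf (tilt λ ps)` and ANY numbers `S_j ≥ ‖∇^{j} q'‖₁` (`2 ≤ j ≤ 2k+1`):
  `|∇^{2k} q(x+k)| ≤ q(x) · λ^{−k} · ( |1−λ|^{2k} + Σ_{j=1}^{2k} C(2k,j)·|1−λ|^{2k−j}·S_{j+1}/(2 q'(x)) )`,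
  where `q'(x) = max q' ≥ 3/(8(2√V'+1))`, `V' ≥ min(λ,λ⁻¹)V`. With the tree's
  `S_j = (2√192·√(2j/V'))^j` this is `|∇^{2k}q(x+k)|/q(x) ≲ √V'·(|1−λ| + C√(k/V'))^{2k}`: at a point where the
  consecutive-atom ratio is `λ = 1 + O(z/√V)` the `2k`-th difference is `(C(z² + k)/V)^k·O(√V)` RELATIVE to
  the atom itself — the pointwise relative `x`-smoothness of a hypergeometric / Poisson-binomial component
  that the block-statistic line of cell pnp-psdrank needs in the moderate-deviation window (MEMO-26 §3,
  input [BULK] of Theorems brick 121 `ChebyshevTracialDesignVirtualPositivityCriterion`).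

* §7 (v2) **the explicit form** (`abs_nabla_even_le_mul_pmf_explicit`): with the tree's `ℓ¹` bounds for the tilted law
  (`absCoeffSum_one_sub_X_pow_mul_genPoly_le`, variance `V' = min(λ,λ⁻¹)V ≥ k`) and the Chebyshev atom bound (§3, `V_t ≤ m/4`):
  `|∇^{2k}q(x+k)| ≤ q(x)·λ^{−k}·( |1−λ|^{2k} + (4(√m+1)/3)·Σ_{j=1}^{2k} C(2k,j)|1−λ|^{2k−j}(2√192·√(2(j+1)/V'))^{j+1} )`;
  §8 `abs_sum_mul_le_of_good_bad`: pointwise relative bounds pass to nonnegative mixtures up to the weight of the bad components.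
* §9 (v3) **the hypergeometric instance** (`coeff_hyperGen_div_coeff_succ`: `h(x)/h(x+1) = (x+1)(d−r+x+1)/((b−x)(r−x))`;
  **`hyperGen_abs_nabla_even_le`**: the §7 bound for `H_{b,d,r}` with that explicit ratio, the hypergeometric variance and `√r`),
  via the tree's Bernoulli-sum representation `exists_bernoulliProd_eq_hyperGen` / `sum_mul_one_sub_eq_of_hyperGen_eq`
  [Vatutin–Mikhailov 1983] — the form the shell-law mixture components (`ShellLawGeneratingPolynomial` §3) come in.
* §10 (v4) **geometric envelopes** (`pmf_sub_le_mul_ratio_pow`, `pmf_add_le_mul_ratio_pow`: `q(x∓j) ≤ q(x)·(ratio at x)^j`, ratio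
  monotonicity) and **`max_pmf_le_mul_pow`**: `max q ≤ q(x)·max(1,ρ_x)^L` for `|mode − x| ≤ L`, `ρ_x` the larger neighbour ratio at `x` —
  with §3 the WINDOW LOWER BOUND `q(x) ≥ 3/(8(2√V+1))·max(1,ρ_x)^{−L}` (step (f) of cell pnp-psdrank's bulk input, MEMO-26 §3).
* §11 (v5) **`hyperGen_argmax_near_mean`**: every maximiser of `H_{b,d,r}` is within `2` of the mean `rb/(b+d)` (the `L` of §10 for
  hypergeometric components is `|x − μ| + 2`).

All PROVED, 0 sorry, two definitions (`tilt`, `tiltNorm`), no named facts; purely algebraic.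

## References
* [Durrett2019] R. Durrett, *Probability: Theory and Examples*, 5th ed. (2019), §2.7 (Cramér's theorem;
  the tilted distribution `F_θ`), Thm. 1.6.4 (Chebyshev's inequality).
* [Karlin1968] S. Karlin, *Total Positivity I* (1968), Ch. 8 §1 (`PF₂` sequences, ratio monotonicity).
* [RollinRoss2010] A. Röllin, N. Ross, *Local limit theorems via Landau–Kolmogorov inequalities*,
  Bernoulli 21 (2015) 851–880, §3 Lemma 3.1, 3.4 (the `ℓ¹` smoothness measures `D_n`).
* [Lange2010] K. Lange, *Numerical Analysis for Statisticians* (2010), §1.7 eq. (1.4).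
* [VatutinMikhailov1983] V. A. Vatutin, V. G. Mikhailov, Theory Probab. Appl. 27 (1983) 734–743, §2 (the hypergeometric
  law is a Bernoulli sum).
-/

namespace Literature.Probability.Distributions

open Finset Polynomial
open Literature.Combinatorics.StablePolynomials (coeff_bernoulliProd_eq_pmf hyperGen coeff_hyperGen exists_bernoulliProd_eq_hyperGen
  sum_mul_one_sub_eq_of_hyperGen_eq eval_one_hyperGen)

namespace PoissonBinomial

/-! ## §1 Exponential tilting of the parameters -/

/-- The **tilted parameters**: `p ↦ pλ/((1−p) + pλ)` — the Bernoulli parameters of the exponentially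
tilted law `q'(k) ∝ λ^k q(k)`. [cite: Durrett2019, §2.7 (the tilted distribution F_θ)] -/
noncomputable def tilt (l : ℝ) (ps : List ℝ) : List ℝ := ps.map fun p => p * l / (1 - p + p * l)

/-- The **tilting normaliser** `M(λ) = Π_k ((1−p_k) + p_k λ)` (the generating polynomial at `λ`).
[cite: Durrett2019, §2.7 (the tilted distribution F_θ, normaliser φ(θ))] -/
noncomputable def tiltNorm (l : ℝ) (ps : List ℝ) : ℝ := (ps.map fun p => 1 - p + p * l).prod

/-- The tilting denominator is positive for `p ∈ [0,1]`, `λ > 0`. [cite: Durrett2019, §2.7] -/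
theorem tilt_den_pos {p l : ℝ} (hp : 0 ≤ p ∧ p ≤ 1) (hl : 0 < l) : 0 < 1 - p + p * l := by
  rcases eq_or_lt_of_le hp.1 with h | h
  · rw [← h]; norm_num
  · nlinarith [hp.2]

/-- `tilt` preserves length. [cite: Durrett2019, §2.7] -/
@[simp] theorem length_tilt (l : ℝ) (ps : List ℝ) : (tilt l ps).length = ps.length := by
  simp [tilt]

/-- Unfolding `tilt` on a cons. [cite: Durrett2019, §2.7] -/
@[simp] theorem tilt_cons (l p : ℝ) (ps : List ℝ) : tilt l (p :: ps) = (p * l / (1 - p + p * l)) :: tilt l ps := rfl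

/-- Unfolding `tilt` on nil. [cite: Durrett2019, §2.7] -/
@[simp] theorem tilt_nil (l : ℝ) : tilt l [] = [] := rfl

/-- Unfolding `tiltNorm` on a cons. [cite: Durrett2019, §2.7] -/
@[simp] theorem tiltNorm_cons (l p : ℝ) (ps : List ℝ) : tiltNorm l (p :: ps) = (1 - p + p * l) * tiltNorm l ps := rfl

/-- Unfolding `tiltNorm` on nil. [cite: Durrett2019, §2.7] -/
@[simp] theorem tiltNorm_nil (l : ℝ) : tiltNorm l [] = 1 := rfl

/-- The tilted parameters are again in `[0,1]`. [cite: Durrett2019, §2.7] -/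
theorem tilt_mem (l : ℝ) (hl : 0 < l) (ps : List ℝ) (hps : ∀ p ∈ ps, 0 ≤ p ∧ p ≤ 1) :
    ∀ p ∈ tilt l ps, 0 ≤ p ∧ p ≤ 1 := by
  intro p' hp'
  obtain ⟨p, hp, rfl⟩ := List.mem_map.1 hp'
  have h := hps p hp
  have hd := tilt_den_pos h hl
  refine ⟨div_nonneg (mul_nonneg h.1 hl.le) hd.le, ?_⟩
  rw [div_le_one hd]
  linarith [h.2]

/-- The normaliser is positive. [cite: Durrett2019, §2.7] -/
theorem tiltNorm_pos (l : ℝ) (hl : 0 < l) : ∀ ps : List ℝ, (∀ p ∈ ps, 0 ≤ p ∧ p ≤ 1) → 0 < tiltNorm l ps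
  | [], _ => by simp
  | p :: ps, h => by
    rw [tiltNorm_cons]
    exact mul_pos (tilt_den_pos (h p (by simp)) hl) (tiltNorm_pos l hl ps fun q hq => h q (by simp [hq]))

/-- **The tilted law is Poisson-binomial with the tilted parameters**: `pmf (tilt λ ps) k · M(λ) = λ^k · pmf ps k`.
[cite: Durrett2019, §2.7 (the tilted distribution F_θ)] [cite: Lange2010, §1.7 eq. (1.4)] -/
theorem pmf_tilt_mul_tiltNorm (l : ℝ) (hl : 0 < l) :
    ∀ (ps : List ℝ), (∀ p ∈ ps, 0 ≤ p ∧ p ≤ 1) → ∀ k : ℕ, pmf (tilt l ps) k * tiltNorm l ps = l ^ k * pmf ps k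
  | [], _, 0 => by simp
  | [], _, k + 1 => by simp
  | p :: ps, h, 0 => by
    have hp := h p (by simp)
    have hd := tilt_den_pos hp hl
    have ih := pmf_tilt_mul_tiltNorm l hl ps (fun q hq => h q (by simp [hq])) 0
    rw [tilt_cons, tiltNorm_cons, pmf_cons_zero, pmf_cons_zero, pow_zero, one_mul] at *
    have h1 : (1 - p * l / (1 - p + p * l)) = (1 - p) / (1 - p + p * l) := by
      field_simp; ring
    rw [h1]
    calc (1 - p) / (1 - p + p * l) * pmf (tilt l ps) 0 * ((1 - p + p * l) * tiltNorm l ps)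
        = (1 - p) * (pmf (tilt l ps) 0 * tiltNorm l ps) * ((1 - p + p * l) / (1 - p + p * l)) := by ring
      _ = (1 - p) * pmf ps 0 := by rw [div_self hd.ne', mul_one, ih]
  | p :: ps, h, k + 1 => by
    have hp := h p (by simp)
    have hd := tilt_den_pos hp hl
    have ih0 := pmf_tilt_mul_tiltNorm l hl ps (fun q hq => h q (by simp [hq])) k
    have ih1 := pmf_tilt_mul_tiltNorm l hl ps (fun q hq => h q (by simp [hq])) (k + 1)
    rw [tilt_cons, tiltNorm_cons, pmf_cons_succ, pmf_cons_succ]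
    have h1 : (1 - p * l / (1 - p + p * l)) = (1 - p) / (1 - p + p * l) := by
      field_simp; ring
    rw [h1]
    calc (p * l / (1 - p + p * l) * pmf (tilt l ps) k + (1 - p) / (1 - p + p * l) * pmf (tilt l ps) (k + 1)) *
          ((1 - p + p * l) * tiltNorm l ps)
        = (p * l * (pmf (tilt l ps) k * tiltNorm l ps) + (1 - p) * (pmf (tilt l ps) (k + 1) * tiltNorm l ps)) *
            ((1 - p + p * l) / (1 - p + p * l)) := by ring
      _ = l ^ (k + 1) * (p * pmf ps k + (1 - p) * pmf ps (k + 1)) := by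
          rw [div_self hd.ne', mul_one, ih0, ih1, pow_succ]; ring

/-- The tilted law in closed form: `pmf (tilt λ ps) k = λ^k · pmf ps k / M(λ)`. [cite: Durrett2019, §2.7] -/
theorem pmf_tilt (l : ℝ) (hl : 0 < l) (ps : List ℝ) (hps : ∀ p ∈ ps, 0 ≤ p ∧ p ≤ 1) (k : ℕ) :
    pmf (tilt l ps) k = l ^ k * pmf ps k / tiltNorm l ps := by
  rw [eq_div_iff (tiltNorm_pos l hl ps hps).ne', pmf_tilt_mul_tiltNorm l hl ps hps k]

/-- The original law from the tilted one: `pmf ps k = λ^{−k}·M(λ)·pmf (tilt λ ps) k`. [cite: Durrett2019, §2.7] -/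
theorem pmf_eq_tilt (l : ℝ) (hl : 0 < l) (ps : List ℝ) (hps : ∀ p ∈ ps, 0 ≤ p ∧ p ≤ 1) (k : ℕ) :
    pmf ps k = (l ^ k)⁻¹ * tiltNorm l ps * pmf (tilt l ps) k := by
  have h := pmf_tilt_mul_tiltNorm l hl ps hps k
  have hlk : (l ^ k) ≠ 0 := pow_ne_zero _ hl.ne'
  field_simp
  linarith

/-- **Variance after tilting**: `p'(1−p') ≥ min(λ, λ⁻¹)·p(1−p)` termwise, hence
`V(tilt λ ps) ≥ min(λ,λ⁻¹)·V(ps)`. [cite: Durrett2019, §2.7] -/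
theorem var_tilt_ge (l : ℝ) (hl : 0 < l) :
    ∀ ps : List ℝ, (∀ p ∈ ps, 0 ≤ p ∧ p ≤ 1) →
      min l l⁻¹ * (ps.map fun p => p * (1 - p)).sum ≤ ((tilt l ps).map fun p => p * (1 - p)).sum
  | [], _ => by simp
  | p :: ps, h => by
    have hp := h p (by simp)
    have hd := tilt_den_pos hp hl
    have ih := var_tilt_ge l hl ps (fun q hq => h q (by simp [hq]))
    simp only [tilt_cons, List.map_cons, List.sum_cons]
    rw [mul_add]
    refine add_le_add ?_ ih
    -- termwise: `min(λ,λ⁻¹)·p(1−p) ≤ pλ/d · (1 − pλ/d) = p(1−p)λ/d²`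
    have hkey : p * l / (1 - p + p * l) * (1 - p * l / (1 - p + p * l)) = p * (1 - p) * (l / (1 - p + p * l) ^ 2) := by
      field_simp; ring
    rw [hkey]
    have hp0 : 0 ≤ p * (1 - p) := mul_nonneg hp.1 (by linarith [hp.2])
    rw [mul_comm (min l l⁻¹)]
    refine mul_le_mul_of_nonneg_left ?_ hp0
    -- `min(λ, λ⁻¹) ≤ λ/d²` since `d ≤ max(1, λ)`: if `λ ≤ 1` then `d ≤ 1` and `λ/d² ≥ λ`; else `d ≤ λ`, `λ/d² ≥ 1/λ`.
    rcases le_or_gt l 1 with hle | hlt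
    · have hd1 : 1 - p + p * l ≤ 1 := by nlinarith [hp.1, hp.2]
      calc min l l⁻¹ ≤ l := min_le_left _ _
        _ = l / 1 ^ 2 := by ring
        _ ≤ l / (1 - p + p * l) ^ 2 := by
            apply div_le_div_of_nonneg_left hl.le (pow_pos hd 2)
            exact pow_le_pow_left₀ hd.le hd1 2
    · have hdl : 1 - p + p * l ≤ l := by nlinarith [hp.1, hp.2]
      calc min l l⁻¹ ≤ l⁻¹ := min_le_right _ _
        _ = l / l ^ 2 := by field_simp
        _ ≤ l / (1 - p + p * l) ^ 2 := by
            apply div_le_div_of_nonneg_left hl.le (pow_pos hd 2)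
            exact pow_le_pow_left₀ hd.le hdl 2

/-! ## §2 The tilted law is modal at the tilting point -/

/-- **The tilted law is maximal at `x` for `λ = q(x)/q(x+1)`**: log-concavity of `q = pmf ps` makes the
consecutive ratios of `k ↦ λ^k q(k)` pass through `1` exactly at `x`. [cite: Karlin1968, Ch. 8 §1] -/
theorem pmf_tilt_le_of_ratio (ps : List ℝ) (hps : ∀ p ∈ ps, 0 ≤ p ∧ p ≤ 1) (x : ℕ)
    (hx : 0 < pmf ps x) (hx1 : 0 < pmf ps (x + 1)) (i : ℕ) :
    pmf (tilt (pmf ps x / pmf ps (x + 1)) ps) i ≤ pmf (tilt (pmf ps x / pmf ps (x + 1)) ps) x := by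
  set l := pmf ps x / pmf ps (x + 1) with hl_def
  have hl : 0 < l := div_pos hx hx1
  have hlc := isLogConcaveSeq_pmf ps hps
  have hM := tiltNorm_pos l hl ps hps
  rw [pmf_tilt l hl ps hps, pmf_tilt l hl ps hps, div_le_div_iff_of_pos_right hM]
  -- the unnormalised tilted sequence `g k = λ^k q k` is unimodal with a mode at `x`
  have hstep_up : ∀ k, k < x → l ^ k * pmf ps k ≤ l ^ (k + 1) * pmf ps (k + 1) := by
    intro k hk
    have h := hlc.mul_succ_le (show k ≤ x by omega)
    have hlq : pmf ps k ≤ l * pmf ps (k + 1) := by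
      rw [hl_def, div_mul_eq_mul_div, le_div_iff₀ hx1]
      linarith [mul_comm (pmf ps (k + 1)) (pmf ps x)]
    calc l ^ k * pmf ps k ≤ l ^ k * (l * pmf ps (k + 1)) := mul_le_mul_of_nonneg_left hlq (pow_nonneg hl.le k)
      _ = l ^ (k + 1) * pmf ps (k + 1) := by ring
  have hstep_down : ∀ k, x ≤ k → l ^ (k + 1) * pmf ps (k + 1) ≤ l ^ k * pmf ps k := by
    intro k hk
    have h := hlc.mul_succ_le hk
    have hlq : l * pmf ps (k + 1) ≤ pmf ps k := by
      rw [hl_def, div_mul_eq_mul_div, div_le_iff₀ hx1]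
      linarith [mul_comm (pmf ps (x + 1)) (pmf ps k)]
    calc l ^ (k + 1) * pmf ps (k + 1) = l ^ k * (l * pmf ps (k + 1)) := by ring
      _ ≤ l ^ k * pmf ps k := mul_le_mul_of_nonneg_left hlq (pow_nonneg hl.le k)
  have hup : ∀ d i, i + d ≤ x → l ^ i * pmf ps i ≤ l ^ (i + d) * pmf ps (i + d) := by
    intro d
    induction d with
    | zero => intro i _; simp
    | succ d ih =>
        intro i hi
        calc l ^ i * pmf ps i ≤ l ^ (i + d) * pmf ps (i + d) := ih i (by omega)
          _ ≤ l ^ (i + d + 1) * pmf ps (i + d + 1) := hstep_up (i + d) (by omega)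
          _ = l ^ (i + (d + 1)) * pmf ps (i + (d + 1)) := by rw [← add_assoc]
  have hdown : ∀ d, l ^ (x + d) * pmf ps (x + d) ≤ l ^ x * pmf ps x := by
    intro d
    induction d with
    | zero => simp
    | succ d ih =>
        calc l ^ (x + (d + 1)) * pmf ps (x + (d + 1)) = l ^ (x + d + 1) * pmf ps (x + d + 1) := by rw [← add_assoc]
          _ ≤ l ^ (x + d) * pmf ps (x + d) := hstep_down (x + d) (by omega)
          _ ≤ l ^ x * pmf ps x := ih
  rcases le_or_gt i x with hix | hxi
  · obtain ⟨d, rfl⟩ := Nat.exists_eq_add_of_le hix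
    exact hup d i le_rfl
  · obtain ⟨d, rfl⟩ := Nat.exists_eq_add_of_lt hxi
    simpa [add_assoc] using hdown (d + 1)

/-! ## §3 The maximal atom is at least of order `V^{-1/2}` (Chebyshev and pigeonhole) -/

/-- Chebyshev's sum: `Σ_i (i − μ)²·q_i = V` for a Poisson-binomial law (`μ = Σ p`, `V = Σ p(1−p)`).
[cite: Durrett2019, Thm. 1.6.4 (Chebyshev's inequality)] [cite: Lange2010, §1.7 eq. (1.4)] -/
theorem sum_sq_sub_mean_mul_pmf (ps : List ℝ) :
    ∑ i ∈ range (ps.length + 1), ((i : ℝ) - ps.sum) ^ 2 * pmf ps i = (ps.map fun p => p * (1 - p)).sum := by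
  have h0 := sum_pmf ps
  have h1 := mean_pmf ps
  have h2 := variance_pmf ps
  rw [h1] at h2
  have hexp : ∑ i ∈ range (ps.length + 1), ((i : ℝ) - ps.sum) ^ 2 * pmf ps i =
      ∑ i ∈ range (ps.length + 1), (i : ℝ) ^ 2 * pmf ps i - 2 * ps.sum * ∑ i ∈ range (ps.length + 1), (i : ℝ) * pmf ps i +
        ps.sum ^ 2 * ∑ i ∈ range (ps.length + 1), pmf ps i := by
    rw [mul_sum, mul_sum, ← sum_sub_distrib, ← sum_add_distrib]
    exact sum_congr rfl fun i _ => by ring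
  rw [hexp, h1, h0, ← h2]
  ring

/-- **The maximal atom of a Poisson-binomial law is `≥ 3/(8(2√V+1))`**: by Chebyshev at least `3/4` of the mass sits on the
`≤ 4√V + 2` integers within `2√V + ½` of the mean. [cite: Durrett2019, Thm. 1.6.4 (Chebyshev's inequality)] -/
theorem exists_max_pmf_ge (ps : List ℝ) (hps : ∀ p ∈ ps, 0 ≤ p ∧ p ≤ 1) :
    ∃ m, (∀ i, pmf ps i ≤ pmf ps m) ∧
      3 / (8 * (2 * Real.sqrt ((ps.map fun p => p * (1 - p)).sum) + 1)) ≤ pmf ps m := by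
  obtain ⟨m, _, hm⟩ := exists_argmax_pmf ps hps
  refine ⟨m, hm, ?_⟩
  set V := (ps.map fun p => p * (1 - p)).sum with hV
  set μ := ps.sum with hμ
  set N := ps.length with hN
  have hq0 : ∀ i, 0 ≤ pmf ps i := pmf_nonneg ps hps
  have hV0 : 0 ≤ V := by
    rw [hV]
    refine List.sum_nonneg ?_
    intro v hv
    obtain ⟨p, hp, rfl⟩ := List.mem_map.1 hv
    have h := hps p hp
    exact mul_nonneg h.1 (by linarith [h.2])
  set a := 2 * Real.sqrt V + 1 / 2 with ha
  have hsV : 0 ≤ Real.sqrt V := Real.sqrt_nonneg V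
  have ha0 : 0 < a := by rw [ha]; linarith
  -- Chebyshev: the mass outside `|i − μ| < a` is `≤ V/a² ≤ 1/4`
  set A := (range (N + 1)).filter (fun i : ℕ => |(i : ℝ) - μ| < a) with hA
  have hcheb : ∑ i ∈ (range (N + 1)).filter (fun i : ℕ => ¬ |(i : ℝ) - μ| < a), pmf ps i ≤ 1 / 4 := by
    have h1 : ∑ i ∈ (range (N + 1)).filter (fun i : ℕ => ¬ |(i : ℝ) - μ| < a), pmf ps i * a ^ 2 ≤
        ∑ i ∈ (range (N + 1)).filter (fun i : ℕ => ¬ |(i : ℝ) - μ| < a), ((i : ℝ) - μ) ^ 2 * pmf ps i := by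
      refine sum_le_sum fun i hi => ?_
      have hia : a ≤ |(i : ℝ) - μ| := not_lt.1 (mem_filter.1 hi).2
      have : a ^ 2 ≤ ((i : ℝ) - μ) ^ 2 := by
        rw [← sq_abs ((i : ℝ) - μ)]
        exact pow_le_pow_left₀ ha0.le hia 2
      calc pmf ps i * a ^ 2 ≤ pmf ps i * ((i : ℝ) - μ) ^ 2 := mul_le_mul_of_nonneg_left this (hq0 i)
        _ = ((i : ℝ) - μ) ^ 2 * pmf ps i := mul_comm _ _
    have h2 : ∑ i ∈ (range (N + 1)).filter (fun i : ℕ => ¬ |(i : ℝ) - μ| < a), ((i : ℝ) - μ) ^ 2 * pmf ps i ≤ V := by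
      rw [hV, hμ, ← sum_sq_sub_mean_mul_pmf ps]
      exact sum_le_sum_of_subset_of_nonneg (filter_subset _ _) fun i _ _ => mul_nonneg (sq_nonneg _) (hq0 i)
    have h3 : V ≤ a ^ 2 / 4 := by
      have : Real.sqrt V ^ 2 = V := Real.sq_sqrt hV0
      rw [ha]; nlinarith
    rw [← sum_mul] at h1
    have ha2 : 0 < a ^ 2 := pow_pos ha0 2
    have h4 : (∑ i ∈ (range (N + 1)).filter (fun i : ℕ => ¬ |(i : ℝ) - μ| < a), pmf ps i) * a ^ 2 ≤ a ^ 2 / 4 := by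
      linarith
    by_contra hcon
    rw [not_le] at hcon
    nlinarith
  -- hence the mass on `A` is `≥ 3/4`
  have hmassA : 3 / 4 ≤ ∑ i ∈ A, pmf ps i := by
    have hsplit := sum_filter_add_sum_filter_not (range (N + 1)) (fun i : ℕ => |(i : ℝ) - μ| < a) (fun i => pmf ps i)
    rw [sum_pmf ps] at hsplit
    rw [hA]
    linarith
  -- `A` is nonempty and sits in a window of `≤ 2a + 1` integers
  have hAne : A.Nonempty := by
    by_contra h
    rw [not_nonempty_iff_eq_empty] at h
    rw [h, sum_empty] at hmassA
    linarith
  have hcardA : (A.card : ℝ) ≤ 2 * a + 1 := by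
    set i₀ := A.min' hAne with hi₀
    have hi₀A : i₀ ∈ A := min'_mem A hAne
    have hi₀μ : |(i₀ : ℝ) - μ| < a := (mem_filter.1 hi₀A).2
    have hsub : A ⊆ Finset.Ico i₀ (i₀ + ⌈2 * a⌉₊) := by
      intro i hi
      have hiμ : |(i : ℝ) - μ| < a := (mem_filter.1 hi).2
      rw [Finset.mem_Ico]
      refine ⟨min'_le A i hi, ?_⟩
      have hlt : (i : ℝ) < (i₀ : ℝ) + 2 * a := by
        rw [abs_lt] at hiμ hi₀μ
        linarith [hiμ.2, hi₀μ.1]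
      have hceil : (2 * a : ℝ) ≤ (⌈2 * a⌉₊ : ℝ) := Nat.le_ceil _
      have : (i : ℝ) < ((i₀ + ⌈2 * a⌉₊ : ℕ) : ℝ) := by push_cast; linarith
      exact_mod_cast this
    have hc := card_le_card hsub
    rw [Nat.card_Ico, Nat.add_sub_cancel_left] at hc
    have hceil_lt : (⌈2 * a⌉₊ : ℝ) < 2 * a + 1 := Nat.ceil_lt_add_one (by linarith)
    have : (A.card : ℝ) ≤ (⌈2 * a⌉₊ : ℝ) := by exact_mod_cast hc
    linarith
  -- pigeonhole
  have hpig : ∑ i ∈ A, pmf ps i ≤ A.card * pmf ps m := by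
    rw [← nsmul_eq_mul, ← sum_const]
    exact sum_le_sum fun i _ => hm i
  have hqm0 : 0 ≤ pmf ps m := hq0 m
  have hfin : 3 / 4 ≤ (2 * a + 1) * pmf ps m :=
    hmassA.trans (hpig.trans (mul_le_mul_of_nonneg_right hcardA hqm0))
  have hden : 0 < 8 * (2 * Real.sqrt V + 1) := by positivity
  rw [div_le_iff₀ hden]
  have : 2 * a + 1 = 4 * Real.sqrt V + 2 := by rw [ha]; ring
  rw [this] at hfin
  linarith

/-! ## §4 The sup norm of a difference from the `ℓ¹` norm one order up -/

/-- Telescoping: `Σ_{i ≤ n} ((1−X)R)_i = R_n`. [cite: RollinRoss2010, §3 (Lemma 3.1)] -/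
theorem sum_coeff_one_sub_X_mul (R : ℝ[X]) (n : ℕ) :
    ∑ i ∈ range (n + 1), ((1 - X) * R).coeff i = R.coeff n := by
  induction n with
  | zero => rw [sum_range_one, coeff_one_sub_X_mul_zero]
  | succ n ih => rw [sum_range_succ, ih, coeff_one_sub_X_mul_succ]; ring

/-- **Sup from `ℓ¹` one order up**: `2·|R_n| ≤ ‖(1−X)·R‖₁` for every real polynomial `R` — the partial sums of the
coefficients of `(1−X)R` are `R_n` from the left and `−R_n` from the right (the total is `((1−X)R)(1) = 0`).
[cite: RollinRoss2010, §3 (Lemma 3.1: the smoothness measure as an ℓ¹ norm)] -/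
theorem two_mul_abs_coeff_le_absCoeffSum (R : ℝ[X]) (n : ℕ) :
    2 * |R.coeff n| ≤ ∑ i ∈ range (((1 - X) * R).natDegree + 1), |((1 - X) * R).coeff i| := by
  -- a common large cut-off
  have hQdeg : ((1 - X) * R).natDegree ≤ max n R.natDegree + 1 :=
    (natDegree_one_sub_X_mul_le R le_rfl).trans (by omega)
  rw [absCoeffSum_eq_of_le _ hQdeg]
  have hleft : ∑ i ∈ range (n + 1), ((1 - X) * R).coeff i = R.coeff n := sum_coeff_one_sub_X_mul R n
  have htot : ∑ i ∈ range (max n R.natDegree + 1 + 1), ((1 - X) * R).coeff i = 0 := by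
    rw [sum_coeff_one_sub_X_mul R]
    exact coeff_eq_zero_of_natDegree_lt (by omega)
  have hnN : n + 1 ≤ max n R.natDegree + 1 + 1 := by omega
  have hright : ∑ i ∈ Ico (n + 1) (max n R.natDegree + 1 + 1), ((1 - X) * R).coeff i = -R.coeff n := by
    have h := sum_range_add_sum_Ico (fun i => ((1 - X) * R).coeff i) hnN
    rw [htot, hleft] at h
    linarith
  have h1 : |R.coeff n| ≤ ∑ i ∈ range (n + 1), |((1 - X) * R).coeff i| := by
    rw [← hleft]; exact abs_sum_le_sum_abs _ _
  have h2 : |R.coeff n| ≤ ∑ i ∈ Ico (n + 1) (max n R.natDegree + 1 + 1), |((1 - X) * R).coeff i| := by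
    rw [← abs_neg, ← hright]; exact abs_sum_le_sum_abs _ _
  have h3 := sum_range_add_sum_Ico (fun i => |((1 - X) * R).coeff i|) hnN
  linarith

/-! ## §5 The tilted difference identity -/

/-- The generating polynomial from the tilted one: `G_{ps}(X) = M(λ)·G_{tilt λ ps}(X/λ)`. [cite: Durrett2019, §2.7] -/
theorem bernoulliProd_eq_tilt (l : ℝ) (hl : 0 < l) (ps : List ℝ) (hps : ∀ p ∈ ps, 0 ≤ p ∧ p ≤ 1) :
    (ps.map fun p => C (1 - p) + C p * X).prod =
      C (tiltNorm l ps) * ((tilt l ps).map fun p => C (1 - p) + C p * X).prod.comp (C l⁻¹ * X) := by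
  ext k
  rw [coeff_bernoulliProd_eq_pmf, coeff_C_mul, comp_C_mul_X_coeff, coeff_bernoulliProd_eq_pmf,
    pmf_eq_tilt l hl ps hps k, inv_pow]
  ring

/-- **The tilted difference identity**: `∇^m q(n)·λ^n = M(λ)·Σ_{j ≤ m} C(m,j)(1−λ)^{m−j}·∇^j q'(n−m+j)`, `q' = pmf (tilt λ ps)`
(terms with `m − j > n` vanish), i.e. `(1 − λY)^m = Σ_j C(m,j)((1−λ)Y)^{m−j}(1−Y)^j` composed with `Y = X/λ`.
[cite: Durrett2019, §2.7 (the tilted distribution F_θ)] -/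
theorem coeff_one_sub_X_pow_mul_eq_tilt (l : ℝ) (hl : 0 < l) (ps : List ℝ) (hps : ∀ p ∈ ps, 0 ≤ p ∧ p ≤ 1) (m n : ℕ) :
    ((1 - X) ^ m * (ps.map fun p => C (1 - p) + C p * X).prod).coeff n * l ^ n =
      tiltNorm l ps * ∑ j ∈ range (m + 1), (m.choose j : ℝ) * (1 - l) ^ (m - j) *
        (if m - j ≤ n then ((1 - X) ^ j * ((tilt l ps).map fun p => C (1 - p) + C p * X).prod).coeff (n - (m - j)) else 0) := by
  set G' := ((tilt l ps).map fun p => C (1 - p) + C p * X).prod with hG'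
  have hl0 : l ≠ 0 := hl.ne'
  -- `(1−X)^m·G = C M · ((1 − C l X)^m · G').comp (C l⁻¹ X)`
  have hcomp : (1 - X : ℝ[X]) ^ m * (ps.map fun p => C (1 - p) + C p * X).prod =
      C (tiltNorm l ps) * ((1 - C l * X) ^ m * G').comp (C l⁻¹ * X) := by
    rw [bernoulliProd_eq_tilt l hl ps hps, mul_comp, pow_comp, sub_comp, one_comp, mul_comp, C_comp, X_comp]
    have h1 : (1 : ℝ[X]) - C l * (C l⁻¹ * X) = 1 - X := by
      rw [← mul_assoc, ← C_mul, mul_inv_cancel₀ hl0, C_1, one_mul]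
    rw [h1]; ring
  -- expand `(1 − C l X)^m = ((1 − X) + C(1−l)·X)^m`
  have hexp : ((1 : ℝ[X]) - C l * X) ^ m = ∑ j ∈ range (m + 1), (1 - X) ^ j * (C (1 - l) * X) ^ (m - j) * (m.choose j : ℝ[X]) := by
    have : (1 : ℝ[X]) - C l * X = (1 - X) + C (1 - l) * X := by
      rw [C_sub, C_1]; ring
    rw [this, add_pow]
  rw [hcomp, coeff_C_mul, comp_C_mul_X_coeff, hexp, sum_mul, finsetSum_coeff, inv_pow]
  have hlj : (l ^ n)⁻¹ * l ^ n = 1 := inv_mul_cancel₀ (pow_ne_zero _ hl0)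
  have hterm : ∀ j ∈ range (m + 1),
      ((1 - X : ℝ[X]) ^ j * (C (1 - l) * X) ^ (m - j) * (m.choose j : ℝ[X]) * G').coeff n =
        (m.choose j : ℝ) * (1 - l) ^ (m - j) *
          (if m - j ≤ n then ((1 - X) ^ j * G').coeff (n - (m - j)) else 0) := by
    intro j _
    have hP : (1 - X : ℝ[X]) ^ j * (C (1 - l) * X) ^ (m - j) * (m.choose j : ℝ[X]) * G' =
        C ((m.choose j : ℝ) * (1 - l) ^ (m - j)) * (X ^ (m - j) * ((1 - X) ^ j * G')) := by
      rw [mul_pow, ← C_pow, C_mul, ← Polynomial.C_eq_natCast]; ring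
    rw [hP, coeff_C_mul, coeff_X_pow_mul']
  calc tiltNorm l ps * ((∑ j ∈ range (m + 1),
          ((1 - X : ℝ[X]) ^ j * (C (1 - l) * X) ^ (m - j) * (m.choose j : ℝ[X]) * G').coeff n) * (l ^ n)⁻¹) * l ^ n
      = tiltNorm l ps * (∑ j ∈ range (m + 1),
          ((1 - X : ℝ[X]) ^ j * (C (1 - l) * X) ^ (m - j) * (m.choose j : ℝ[X]) * G').coeff n) * ((l ^ n)⁻¹ * l ^ n) := by
        ring
    _ = tiltNorm l ps * ∑ j ∈ range (m + 1),
          ((1 - X : ℝ[X]) ^ j * (C (1 - l) * X) ^ (m - j) * (m.choose j : ℝ[X]) * G').coeff n := by rw [hlj, mul_one]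
    _ = _ := by rw [sum_congr rfl hterm]

/-! ## §6 The pointwise relative bound for even differences -/

/-- **POINTWISE RELATIVE SMOOTHNESS OF A POISSON-BINOMIAL LAW (even differences).** For parameters in `[0,1]`, a point `x`
with `q(x), q(x+1) > 0`, the tilt `λ = q(x)/q(x+1)`, the tilted law `q' = pmf (tilt λ ps)` (maximal at `x`, §2) and any bounds
`S_{j+1} ≥ ‖∇^{j+1} q'‖₁` (`1 ≤ j ≤ 2k`):
`|∇^{2k} q(x+k)| ≤ q(x)·λ^{−k}·( |1−λ|^{2k} + Σ_{j=1}^{2k} C(2k,j)·|1−λ|^{2k−j}·S_{j+1}/(2q'(x)) )`.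
[cite: Durrett2019, §2.7 (the tilted distribution F_θ)] [cite: RollinRoss2010, §3 Lemma 3.1, 3.4] [cite: Karlin1968, Ch. 8 §1] -/
theorem abs_nabla_even_le_mul_pmf (ps : List ℝ) (hps : ∀ p ∈ ps, 0 ≤ p ∧ p ≤ 1) (x k : ℕ)
    (hx : 0 < pmf ps x) (hx1 : 0 < pmf ps (x + 1)) {l : ℝ} (hl : l = pmf ps x / pmf ps (x + 1))
    (S : ℕ → ℝ)
    (hS : ∀ j, 1 ≤ j → j ≤ 2 * k →
      ∑ i ∈ range (((1 - X) ^ (j + 1) * ((tilt l ps).map fun p => C (1 - p) + C p * X).prod).natDegree + 1),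
        |((1 - X) ^ (j + 1) * ((tilt l ps).map fun p => C (1 - p) + C p * X).prod).coeff i| ≤ S (j + 1)) :
    |((1 - X) ^ (2 * k) * (ps.map fun p => C (1 - p) + C p * X).prod).coeff (x + k)| ≤
      pmf ps x * (l ^ k)⁻¹ * (|1 - l| ^ (2 * k) +
        ∑ j ∈ Ico 1 (2 * k + 1), ((2 * k).choose j : ℝ) * |1 - l| ^ (2 * k - j) * (S (j + 1) / (2 * pmf (tilt l ps) x))) := by
  set G' := ((tilt l ps).map fun p => C (1 - p) + C p * X).prod with hG'
  have hl0 : 0 < l := by rw [hl]; exact div_pos hx hx1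
  have hps' := tilt_mem l hl0 ps hps
  have hM := tiltNorm_pos l hl0 ps hps
  -- the tilted law is maximal at `x`
  have hmode : ∀ i, pmf (tilt l ps) i ≤ pmf (tilt l ps) x := by
    intro i; rw [hl]; exact pmf_tilt_le_of_ratio ps hps x hx hx1 i
  have hq'x : 0 < pmf (tilt l ps) x := by
    rw [pmf_tilt l hl0 ps hps x]
    exact div_pos (mul_pos (pow_pos hl0 _) hx) hM
  -- the identity, with absolute values
  have hid := coeff_one_sub_X_pow_mul_eq_tilt l hl0 ps hps (2 * k) (x + k)
  have hlxk : 0 < l ^ (x + k) := pow_pos hl0 _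
  -- bound each term of the sum
  have hterm : ∀ j ∈ range (2 * k + 1),
      |((2 * k).choose j : ℝ) * (1 - l) ^ (2 * k - j) *
        (if 2 * k - j ≤ x + k then ((1 - X) ^ j * G').coeff (x + k - (2 * k - j)) else 0)| ≤
      ((2 * k).choose j : ℝ) * |1 - l| ^ (2 * k - j) *
        (if j = 0 then pmf (tilt l ps) x else S (j + 1) / 2) := by
    intro j hj
    have hj' : j ≤ 2 * k := Nat.lt_succ_iff.1 (mem_range.1 hj)
    rw [abs_mul, abs_mul, Nat.abs_cast, abs_pow]
    refine mul_le_mul_of_nonneg_left ?_ (by positivity)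
    split_ifs with hle hj0 hj0
    · -- `j = 0`: a coefficient of `G'` is an atom of the tilted law, `≤` its maximum
      subst hj0
      rw [pow_zero, one_mul, coeff_bernoulliProd_eq_pmf, abs_of_nonneg (pmf_nonneg _ hps' _)]
      exact hmode _
    · -- `1 ≤ j`: sup from `ℓ¹` one order up
      have h2 := two_mul_abs_coeff_le_absCoeffSum ((1 - X) ^ j * G') (x + k - (2 * k - j))
      have h3 := hS j (by omega) hj'
      rw [show (1 - X : ℝ[X]) ^ (j + 1) * G' = (1 - X) * ((1 - X) ^ j * G') by rw [pow_succ]; ring] at h3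
      linarith
    · rw [abs_zero]; exact (pmf_nonneg _ hps' _).trans (hmode 0)
    · rw [abs_zero]
      have h3 := hS j (by omega) hj'
      have h4 : 0 ≤ ∑ i ∈ range (((1 - X) ^ (j + 1) * G').natDegree + 1), |((1 - X) ^ (j + 1) * G').coeff i| :=
        sum_nonneg fun i _ => abs_nonneg _
      linarith
  -- `|∇^{2k} q(x+k)|·λ^{x+k} ≤ M·Σ_j (…)`
  have hmain : |((1 - X) ^ (2 * k) * (ps.map fun p => C (1 - p) + C p * X).prod).coeff (x + k)| * l ^ (x + k) ≤
      tiltNorm l ps * ∑ j ∈ range (2 * k + 1), ((2 * k).choose j : ℝ) * |1 - l| ^ (2 * k - j) *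
        (if j = 0 then pmf (tilt l ps) x else S (j + 1) / 2) := by
    rw [← abs_of_pos hlxk, ← abs_mul, hid, abs_mul, abs_of_pos hM]
    refine mul_le_mul_of_nonneg_left ((abs_sum_le_sum_abs _ _).trans (sum_le_sum hterm)) hM.le
  -- split off `j = 0` and rewrite `M·q'(x) = λ^x·q(x)`
  rw [← sum_range_add_sum_Ico _ (by omega : 1 ≤ 2 * k + 1), sum_range_one] at hmain
  simp only [Nat.choose_zero_right, Nat.cast_one, one_mul, Nat.sub_zero, if_true] at hmain
  have hIco : ∑ j ∈ Ico 1 (2 * k + 1), ((2 * k).choose j : ℝ) * |1 - l| ^ (2 * k - j) *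
      (if j = 0 then pmf (tilt l ps) x else S (j + 1) / 2) =
      ∑ j ∈ Ico 1 (2 * k + 1), ((2 * k).choose j : ℝ) * |1 - l| ^ (2 * k - j) * (S (j + 1) / 2) := by
    refine sum_congr rfl fun j hj => ?_
    rw [if_neg (by have := (mem_Ico.1 hj).1; omega)]
  rw [hIco] at hmain
  have hMq : tiltNorm l ps * pmf (tilt l ps) x = l ^ x * pmf ps x := by
    rw [mul_comm]; exact pmf_tilt_mul_tiltNorm l hl0 ps hps x
  -- compare with the target after clearing `λ^{x+k}`
  have hq'x0 : pmf (tilt l ps) x ≠ 0 := hq'x.ne'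
  have hl00 : l ≠ 0 := hl0.ne'
  have hsum : ∑ j ∈ Ico 1 (2 * k + 1), ((2 * k).choose j : ℝ) * |1 - l| ^ (2 * k - j) *
      (S (j + 1) / (2 * pmf (tilt l ps) x)) =
      (pmf (tilt l ps) x)⁻¹ * ∑ j ∈ Ico 1 (2 * k + 1), ((2 * k).choose j : ℝ) * |1 - l| ^ (2 * k - j) * (S (j + 1) / 2) := by
    rw [mul_sum]
    refine sum_congr rfl fun j _ => ?_
    field_simp
  have key : tiltNorm l ps * (|1 - l| ^ (2 * k) * pmf (tilt l ps) x +
        ∑ j ∈ Ico 1 (2 * k + 1), ((2 * k).choose j : ℝ) * |1 - l| ^ (2 * k - j) * (S (j + 1) / 2)) =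
      pmf ps x * (l ^ k)⁻¹ * (|1 - l| ^ (2 * k) +
        ∑ j ∈ Ico 1 (2 * k + 1), ((2 * k).choose j : ℝ) * |1 - l| ^ (2 * k - j) * (S (j + 1) / (2 * pmf (tilt l ps) x))) *
        l ^ (x + k) := by
    rw [hsum]
    have hM' : tiltNorm l ps = l ^ x * pmf ps x / pmf (tilt l ps) x := by
      rw [eq_div_iff hq'x0, hMq]
    rw [hM', pow_add]
    field_simp
  rw [key] at hmain
  exact le_of_mul_le_mul_right hmain hlxk

/-! ## §7 The explicit form: constants from the tree's `ℓ¹` bounds and the Chebyshev atom bound -/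

/-- Each Bernoulli variance is `≤ 1/4`, so `V(ps) ≤ |ps|/4`. [cite: RollinRoss2010, §4.1 (Thm 4.2)] -/
theorem varSum_le_length_div_four (ps : List ℝ) : (ps.map fun p => p * (1 - p)).sum ≤ (ps.length : ℝ) / 4 := by
  induction ps with
  | nil => simp
  | cons p ps ih =>
      simp only [List.map_cons, List.sum_cons, List.length_cons]
      push_cast
      have : p * (1 - p) ≤ 1 / 4 := by nlinarith [sq_nonneg (p - 1 / 2)]
      linarith

/-- **POINTWISE RELATIVE SMOOTHNESS, EXPLICIT FORM.** For parameters in `[0,1]` (`m` of them, `V = Σ p(1−p)`), a point `x` with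
`q(x), q(x+1) > 0`, `λ = q(x)/q(x+1)`, `V' = min(λ,λ⁻¹)·V` with `k ≤ V'` (so the tree's `ℓ¹` bounds apply to the tilted law up to
order `2k+1`): `|∇^{2k} q(x+k)| ≤ q(x)·λ^{−k}·( |1−λ|^{2k} + (4(√m+1)/3)·Σ_{j=1}^{2k} C(2k,j)|1−λ|^{2k−j}(2√192·√(2(j+1)/V'))^{j+1} )`.
Reading: where the consecutive-atom ratio is `λ = e^{±θ}`, `θ ≈ |x−μ|/V`, the `2k`-th difference at `x` is
`≲ √m·(|1−λ| + C√(k/V))^{2k} ≍ √m·(C(z² + k)/V)^k` times the atom `q(x)` itself. [cite: Durrett2019, §2.7]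
[cite: RollinRoss2010, §3 Lemma 3.4, §4.1 Thm 4.2] [cite: Karlin1968, Ch. 8 §1] -/
theorem abs_nabla_even_le_mul_pmf_explicit (ps : List ℝ) (hps : ∀ p ∈ ps, 0 ≤ p ∧ p ≤ 1) (x k : ℕ)
    (hx : 0 < pmf ps x) (hx1 : 0 < pmf ps (x + 1)) {l : ℝ} (hl : l = pmf ps x / pmf ps (x + 1))
    (hV' : 0 < min l l⁻¹ * (ps.map fun p => p * (1 - p)).sum)
    (hk : (k : ℝ) ≤ min l l⁻¹ * (ps.map fun p => p * (1 - p)).sum) :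
    |((1 - X) ^ (2 * k) * (ps.map fun p => C (1 - p) + C p * X).prod).coeff (x + k)| ≤
      pmf ps x * (l ^ k)⁻¹ * (|1 - l| ^ (2 * k) +
        4 * (Real.sqrt ps.length + 1) / 3 * ∑ j ∈ Ico 1 (2 * k + 1), ((2 * k).choose j : ℝ) * |1 - l| ^ (2 * k - j) *
          (2 * Real.sqrt 192 * Real.sqrt (2 * ((j : ℝ) + 1) / (min l l⁻¹ * (ps.map fun p => p * (1 - p)).sum))) ^ (j + 1)) := by
  set V := (ps.map fun p => p * (1 - p)).sum with hV
  set V' := min l l⁻¹ * V with hV'def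
  set Vt := ((tilt l ps).map fun p => p * (1 - p)).sum with hVt
  have hl0 : 0 < l := by rw [hl]; exact div_pos hx hx1
  have hps' := tilt_mem l hl0 ps hps
  have hVtV' : V' ≤ Vt := var_tilt_ge l hl0 ps hps
  have hVt0 : 0 < Vt := lt_of_lt_of_le hV' hVtV'
  have hVtm : Vt ≤ ps.length / 4 := by
    have := varSum_le_length_div_four (tilt l ps); rwa [length_tilt] at this
  -- the `ℓ¹` bounds for the tilted law, with `V_t` replaced by the smaller `V'`
  set S : ℕ → ℝ := fun i => (2 * Real.sqrt 192 * Real.sqrt (2 * (i : ℝ) / V')) ^ i with hSdef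
  have hS : ∀ j, 1 ≤ j → j ≤ 2 * k →
      ∑ i ∈ range (((1 - X) ^ (j + 1) * ((tilt l ps).map fun p => C (1 - p) + C p * X).prod).natDegree + 1),
        |((1 - X) ^ (j + 1) * ((tilt l ps).map fun p => C (1 - p) + C p * X).prod).coeff i| ≤ S (j + 1) := by
    intro j _ hj2
    have hj2R : (j : ℝ) ≤ 2 * k := by exact_mod_cast hj2
    have hjV : ((j + 1 : ℕ) : ℝ) - 1 ≤ 2 * Vt := by push_cast; linarith
    refine (absCoeffSum_one_sub_X_pow_mul_genPoly_le (tilt l ps) hps' hVt0 hjV).trans ?_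
    rw [hSdef]
    refine pow_le_pow_left₀ (by positivity) ?_ _
    refine mul_le_mul_of_nonneg_left (Real.sqrt_le_sqrt ?_) (by positivity)
    push_cast
    exact div_le_div_of_nonneg_left (by positivity) hV' hVtV'
  have hmain := abs_nabla_even_le_mul_pmf ps hps x k hx hx1 hl S hS
  -- the atom of the tilted law at `x` is its maximum, `≥ 3/(8(2√V_t+1)) ≥ 3/(8(√m+1))`
  obtain ⟨m', hm'max, hm'ge⟩ := exists_max_pmf_ge (tilt l ps) hps'
  have hmode : ∀ i, pmf (tilt l ps) i ≤ pmf (tilt l ps) x := by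
    intro i; rw [hl]; exact pmf_tilt_le_of_ratio ps hps x hx hx1 i
  have hsqrt : 2 * Real.sqrt Vt ≤ Real.sqrt ps.length := by
    have h4 : Real.sqrt (4 * Vt) = 2 * Real.sqrt Vt := by
      rw [Real.sqrt_mul (by norm_num : (0 : ℝ) ≤ 4), show Real.sqrt (4 : ℝ) = 2 from by
        rw [show (4 : ℝ) = 2 * 2 by norm_num, Real.sqrt_mul_self (by norm_num)]]
    rw [← h4]
    exact Real.sqrt_le_sqrt (by linarith)
  have hq'x : 3 / (8 * (Real.sqrt ps.length + 1)) ≤ pmf (tilt l ps) x := by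
    have h1 : 3 / (8 * (Real.sqrt ps.length + 1)) ≤ 3 / (8 * (2 * Real.sqrt Vt + 1)) :=
      div_le_div_of_nonneg_left (by norm_num) (by positivity) (by linarith)
    exact h1.trans (hm'ge.trans (hmode m'))
  have hq'x0 : 0 < pmf (tilt l ps) x := lt_of_lt_of_le (by positivity) hq'x
  -- termwise: `S_{j+1}/(2q'(x)) ≤ (4(√m+1)/3)·S_{j+1}`
  refine hmain.trans ?_
  have hpre : 0 ≤ pmf ps x * (l ^ k)⁻¹ := mul_nonneg hx.le (inv_nonneg.2 (pow_nonneg hl0.le _))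
  refine mul_le_mul_of_nonneg_left (add_le_add le_rfl ?_) hpre
  rw [mul_sum]
  refine sum_le_sum fun j hj => ?_
  have hSj : 0 ≤ S (j + 1) := by rw [hSdef]; positivity
  have hcj : 0 ≤ ((2 * k).choose j : ℝ) * |1 - l| ^ (2 * k - j) := by positivity
  have hinv : S (j + 1) / (2 * pmf (tilt l ps) x) ≤ 4 * (Real.sqrt ps.length + 1) / 3 * S (j + 1) := by
    rw [div_le_iff₀ (by positivity)]
    have : S (j + 1) * 1 ≤ S (j + 1) * (4 * (Real.sqrt ps.length + 1) / 3 * (2 * pmf (tilt l ps) x)) := by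
      refine mul_le_mul_of_nonneg_left ?_ hSj
      have h8 : (0 : ℝ) < 8 * (Real.sqrt ps.length + 1) := by positivity
      rw [div_le_iff₀ h8] at hq'x
      nlinarith
    linarith
  calc ((2 * k).choose j : ℝ) * |1 - l| ^ (2 * k - j) * (S (j + 1) / (2 * pmf (tilt l ps) x))
      ≤ ((2 * k).choose j : ℝ) * |1 - l| ^ (2 * k - j) * (4 * (Real.sqrt ps.length + 1) / 3 * S (j + 1)) :=
        mul_le_mul_of_nonneg_left hinv hcj
    _ = 4 * (Real.sqrt ps.length + 1) / 3 * (((2 * k).choose j : ℝ) * |1 - l| ^ (2 * k - j) *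
          (2 * Real.sqrt 192 * Real.sqrt (2 * (((j + 1 : ℕ) : ℝ)) / V')) ^ (j + 1)) := by rw [hSdef]; ring
    _ = _ := by push_cast; ring

/-! ## §8 Mixtures: pointwise relative bounds pass to nonnegative mixtures up to the weight of the bad components -/

/-- **Relative bounds pass to mixtures.** For nonnegative weights `w` and components with `|D_κ| ≤ ε·c_κ` on a set of GOOD components
(`c_κ ≥ 0`) and `|D_κ| ≤ A` on all of them: `|Σ_κ w_κ D_κ| ≤ ε·Σ_κ w_κ c_κ + A·Σ_{κ bad} w_κ` — used with `D_κ = ∇^{2k}h_κ(x+k)`,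
`c_κ = h_κ(x)` (§6) for the hypergeometric components of a shell law. [cite: RollinRoss2010, §3 (Lemma 3.3: conditioning / mixtures)] -/
theorem abs_sum_mul_le_of_good_bad {ι : Type*} [DecidableEq ι] (s good : Finset ι) (hgood : good ⊆ s)
    (w D c : ι → ℝ) {ε A : ℝ} (hw : ∀ κ ∈ s, 0 ≤ w κ) (hc : ∀ κ ∈ s, 0 ≤ c κ) (hε : 0 ≤ ε)
    (hgoodb : ∀ κ ∈ good, |D κ| ≤ ε * c κ) (hall : ∀ κ ∈ s, |D κ| ≤ A) :
    |∑ κ ∈ s, w κ * D κ| ≤ ε * ∑ κ ∈ s, w κ * c κ + A * ∑ κ ∈ s \ good, w κ := by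
  calc |∑ κ ∈ s, w κ * D κ| ≤ ∑ κ ∈ s, |w κ * D κ| := abs_sum_le_sum_abs _ _
    _ = ∑ κ ∈ good, w κ * |D κ| + ∑ κ ∈ s \ good, w κ * |D κ| := by
        rw [← sum_sdiff hgood, add_comm]
        congr 1 <;> exact sum_congr rfl fun κ hκ => by
          rw [abs_mul, abs_of_nonneg (hw κ (by first | exact hgood hκ | exact (mem_sdiff.1 hκ).1))]
    _ ≤ ∑ κ ∈ good, w κ * (ε * c κ) + ∑ κ ∈ s \ good, w κ * A :=
        add_le_add (sum_le_sum fun κ hκ => mul_le_mul_of_nonneg_left (hgoodb κ hκ) (hw κ (hgood hκ)))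
          (sum_le_sum fun κ hκ => mul_le_mul_of_nonneg_left (hall κ (mem_sdiff.1 hκ).1) (hw κ (mem_sdiff.1 hκ).1))
    _ ≤ ε * ∑ κ ∈ s, w κ * c κ + A * ∑ κ ∈ s \ good, w κ := by
        rw [mul_sum, mul_sum, ← sum_sdiff hgood]
        have h1 : ∑ κ ∈ good, w κ * (ε * c κ) = ∑ κ ∈ good, ε * (w κ * c κ) := sum_congr rfl fun κ _ => by ring
        have h2 : ∑ κ ∈ s \ good, w κ * A = ∑ κ ∈ s \ good, A * w κ := sum_congr rfl fun κ _ => by ring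
        have h3 : 0 ≤ ∑ κ ∈ s \ good, ε * (w κ * c κ) :=
          sum_nonneg fun κ hκ => mul_nonneg hε (mul_nonneg (hw κ (mem_sdiff.1 hκ).1) (hc κ (mem_sdiff.1 hκ).1))
        rw [h1, h2]; linarith

/-! ## §9 The hypergeometric instance: explicit consecutive-atom ratio and the pointwise relative bound -/

/-- **The consecutive-atom ratio of a hypergeometric law**: `h(x)/h(x+1) = (x+1)(d−r+x+1)/((b−x)(r−x))` for
`x + 1 ≤ min(b, r)` and `r ≤ d + x` (so that both atoms are positive), in the generating-polynomial currency
`h(k) ∝ coeff_k H_{b,d,r} = C(b,k)C(d,r−k)`. [cite: VatutinMikhailov1983, §2] [cite: Durrett2019, §2.7] -/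
theorem coeff_hyperGen_div_coeff_succ {b d r x : ℕ} (hxb : x + 1 ≤ b) (hxr : x + 1 ≤ r) (hxd : r ≤ d + x) :
    (hyperGen b d r).coeff x / (hyperGen b d r).coeff (x + 1) =
      ((x : ℝ) + 1) * ((d : ℝ) - r + x + 1) / (((b : ℝ) - x) * ((r : ℝ) - x)) := by
  rw [coeff_hyperGen, coeff_hyperGen, if_pos (by omega), if_pos hxr]
  -- `C(b,x+1)(x+1) = C(b,x)(b−x)` and `C(d,r−x)(r−x) = C(d,r−x−1)(d−r+x+1)`
  have h1 : ((b.choose (x + 1) : ℕ) : ℝ) * ((x : ℝ) + 1) = ((b.choose x : ℕ) : ℝ) * ((b : ℝ) - x) := by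
    have := Nat.choose_succ_right_eq b x
    have hbx : ((b - x : ℕ) : ℝ) = (b : ℝ) - x := by rw [Nat.cast_sub (by omega)]
    rw [← hbx]; exact_mod_cast this
  have h2 : ((d.choose (r - x) : ℕ) : ℝ) * ((r : ℝ) - x) = ((d.choose (r - (x + 1)) : ℕ) : ℝ) * ((d : ℝ) - r + x + 1) := by
    have := Nat.choose_succ_right_eq d (r - (x + 1))
    rw [show r - (x + 1) + 1 = r - x by omega] at this
    have h2' : ((d.choose (r - x) : ℕ) : ℝ) * ((r - x : ℕ) : ℝ) =
        ((d.choose (r - (x + 1)) : ℕ) : ℝ) * ((d - (r - (x + 1)) : ℕ) : ℝ) := by exact_mod_cast this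
    have hrx : ((r - x : ℕ) : ℝ) = (r : ℝ) - x := by rw [Nat.cast_sub (by omega)]
    have hdx : ((d - (r - (x + 1)) : ℕ) : ℝ) = (d : ℝ) - r + x + 1 := by
      rw [Nat.cast_sub (by omega), Nat.cast_sub (by omega)]; push_cast; ring
    rwa [hrx, hdx] at h2'
  have hbx0 : (0 : ℝ) < (b : ℝ) - x := by
    have : (x : ℝ) + 1 ≤ b := by exact_mod_cast hxb
    linarith
  have hrx0 : (0 : ℝ) < (r : ℝ) - x := by
    have : (x : ℝ) + 1 ≤ r := by exact_mod_cast hxr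
    linarith
  have hx10 : (0 : ℝ) < (x : ℝ) + 1 := by positivity
  have hcx1 : (0 : ℝ) < ((b.choose (x + 1) : ℕ) : ℝ) := by exact_mod_cast Nat.choose_pos (by omega)
  have hcd : (0 : ℝ) < ((d.choose (r - (x + 1)) : ℕ) : ℝ) := by exact_mod_cast Nat.choose_pos (by omega)
  push_cast
  rw [div_eq_div_iff (by positivity) (by positivity)]
  -- `C(b,x)C(d,r−x)·((b−x)(r−x)) = (x+1)(d−r+x+1)·(C(b,x+1)C(d,r−x−1))`
  have : ((b.choose x : ℕ) : ℝ) * ((b : ℝ) - x) * (((d.choose (r - x) : ℕ) : ℝ) * ((r : ℝ) - x)) =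
      ((b.choose (x + 1) : ℕ) : ℝ) * ((x : ℝ) + 1) * (((d.choose (r - (x + 1)) : ℕ) : ℝ) * ((d : ℝ) - r + x + 1)) := by
    rw [h1, h2]
  linear_combination this

/-- **POINTWISE RELATIVE SMOOTHNESS OF A HYPERGEOMETRIC LAW (explicit).** In the currency `H_{b,d,r}` (coefficients
`C(b,k)C(d,r−k) = C(b+d,r)·h(k)`): for `x + 1 ≤ min(b,r)`, `r ≤ d + x`, with the explicit ratio
`λ = (x+1)(d−r+x+1)/((b−x)(r−x))`, the hypergeometric variance `V = rbd(b+d−r)/((b+d)²(b+d−1))` and `V' = min(λ,λ⁻¹)V ≥ k`,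
`|coeff_{x+k}((1−X)^{2k}H_{b,d,r})| ≤ coeff_x(H_{b,d,r})·λ^{−k}·( |1−λ|^{2k} + (4(√r+1)/3)·Σ_{j=1}^{2k} C(2k,j)|1−λ|^{2k−j}(2√192·√(2(j+1)/V'))^{j+1} )`
— via the Bernoulli-sum representation of the hypergeometric law (tree `exists_bernoulliProd_eq_hyperGen`,
`sum_mul_one_sub_eq_of_hyperGen_eq`) and §7. [cite: VatutinMikhailov1983, §2] [cite: Durrett2019, §2.7]
[cite: RollinRoss2010, §4.1 Thm 4.2] -/
theorem hyperGen_abs_nabla_even_le {b d r : ℕ} (hr : r ≤ b + d) (x k : ℕ) (hxb : x + 1 ≤ b) (hxr : x + 1 ≤ r)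
    (hxd : r ≤ d + x) {l V : ℝ} (hl : l = ((x : ℝ) + 1) * ((d : ℝ) - r + x + 1) / (((b : ℝ) - x) * ((r : ℝ) - x)))
    (hVdef : V = (r : ℝ) * b * d * ((b : ℝ) + d - r) / (((b : ℝ) + d) ^ 2 * ((b : ℝ) + d - 1)))
    (hV' : 0 < min l l⁻¹ * V) (hk : (k : ℝ) ≤ min l l⁻¹ * V) :
    |((1 - X) ^ (2 * k) * hyperGen b d r).coeff (x + k)| ≤
      (hyperGen b d r).coeff x * (l ^ k)⁻¹ * (|1 - l| ^ (2 * k) +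
        4 * (Real.sqrt r + 1) / 3 * ∑ j ∈ Ico 1 (2 * k + 1), ((2 * k).choose j : ℝ) * |1 - l| ^ (2 * k - j) *
          (2 * Real.sqrt 192 * Real.sqrt (2 * ((j : ℝ) + 1) / (min l l⁻¹ * V))) ^ (j + 1)) := by
  obtain ⟨ps, hps0, hlen, hG⟩ := exists_bernoulliProd_eq_hyperGen hr
  have hps : ∀ p ∈ ps, 0 ≤ p ∧ p ≤ 1 := fun p hp => ⟨(hps0 p hp).1.le, (hps0 p hp).2⟩
  have hVps : (ps.map fun p => p * (1 - p)).sum = V := by rw [hVdef]; exact sum_mul_one_sub_eq_of_hyperGen_eq hr hlen hG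
  set G := (ps.map fun p => C (1 - p) + C p * X).prod with hGdef
  set c : ℝ := (((b + d).choose r : ℕ) : ℝ) with hc
  have hc0 : 0 < c := by rw [hc]; exact_mod_cast Nat.choose_pos hr
  -- coefficients: `coeff_k H = c · pmf ps k`
  have hcoef : ∀ i, (hyperGen b d r).coeff i = c * pmf ps i := by
    intro i; rw [hG, coeff_C_mul, coeff_bernoulliProd_eq_pmf]
  have hposx : 0 < (hyperGen b d r).coeff x := by
    rw [coeff_hyperGen, if_pos (by omega)]
    exact_mod_cast Nat.mul_pos (Nat.choose_pos (by omega)) (Nat.choose_pos (by omega))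
  have hposx1 : 0 < (hyperGen b d r).coeff (x + 1) := by
    rw [coeff_hyperGen, if_pos hxr]
    exact_mod_cast Nat.mul_pos (Nat.choose_pos hxb) (Nat.choose_pos (by omega))
  have hx : 0 < pmf ps x := by
    have := hcoef x; rw [this] at hposx; exact pos_of_mul_pos_right hposx hc0.le
  have hx1 : 0 < pmf ps (x + 1) := by
    have := hcoef (x + 1); rw [this] at hposx1; exact pos_of_mul_pos_right hposx1 hc0.le
  -- the ratio of the representation is the explicit hypergeometric ratio
  have hlps : l = pmf ps x / pmf ps (x + 1) := by
    rw [hl, ← coeff_hyperGen_div_coeff_succ hxb hxr hxd, hcoef, hcoef, mul_div_mul_left _ _ hc0.ne']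
  rw [← hVps] at hV' hk
  have hmain := abs_nabla_even_le_mul_pmf_explicit ps hps x k hx hx1 hlps hV' hk
  -- transport through the constant `c`
  have hnab : ((1 - X) ^ (2 * k) * hyperGen b d r).coeff (x + k) = c * ((1 - X) ^ (2 * k) * G).coeff (x + k) := by
    rw [hG, ← coeff_C_mul]; congr 1; ring
  rw [hnab, abs_mul, abs_of_pos hc0, hcoef x]
  rw [hVps] at hmain
  have hsqrt : Real.sqrt ps.length ≤ Real.sqrt r := Real.sqrt_le_sqrt (by exact_mod_cast hlen)
  have hl0 : 0 < l := by rw [hlps]; exact div_pos hx hx1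
  -- `c·|…| ≤ c·(pmf x · …)` with `√|ps| ≤ √r`
  calc c * |((1 - X) ^ (2 * k) * G).coeff (x + k)|
      ≤ c * (pmf ps x * (l ^ k)⁻¹ * (|1 - l| ^ (2 * k) +
        4 * (Real.sqrt ps.length + 1) / 3 * ∑ j ∈ Ico 1 (2 * k + 1), ((2 * k).choose j : ℝ) * |1 - l| ^ (2 * k - j) *
          (2 * Real.sqrt 192 * Real.sqrt (2 * ((j : ℝ) + 1) / (min l l⁻¹ * V))) ^ (j + 1))) :=
        mul_le_mul_of_nonneg_left hmain hc0.le
    _ ≤ c * (pmf ps x * (l ^ k)⁻¹ * (|1 - l| ^ (2 * k) +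
        4 * (Real.sqrt r + 1) / 3 * ∑ j ∈ Ico 1 (2 * k + 1), ((2 * k).choose j : ℝ) * |1 - l| ^ (2 * k - j) *
          (2 * Real.sqrt 192 * Real.sqrt (2 * ((j : ℝ) + 1) / (min l l⁻¹ * V))) ^ (j + 1))) := by
        refine mul_le_mul_of_nonneg_left (mul_le_mul_of_nonneg_left (add_le_add le_rfl ?_) ?_) hc0.le
        · refine mul_le_mul_of_nonneg_right ?_ (sum_nonneg fun j _ => by positivity)
          exact div_le_div_of_nonneg_right (by linarith) (by norm_num)
        · exact mul_nonneg hx.le (inv_nonneg.2 (pow_nonneg hl0.le _))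
    _ = _ := by ring

/-! ## §10 Geometric envelopes: every atom controls the atoms on either side through the ratio AT that atom -/

/-- **Left geometric envelope of a log-concave law**: for `q = pmf ps` (parameters in `[0,1]`) and a point `x` with `q(x) > 0`,
`q(x − j) ≤ q(x)·(q(x−1)/q(x))^j` for all `j ≤ x` — the consecutive ratios `q(y)/q(y+1)` are non-decreasing in `y`
[Karlin 1968, Ch. 8 §1]. Equivalently `q(x) ≥ q(m)·(q(x)/q(x−1))^{x−m}` for a maximiser `m ≤ x`: a LOWER bound for the atom at `x`
from the max atom (§3) and the ratio at `x` (explicit for hypergeometric laws, §9). [cite: Karlin1968, Ch. 8 §1] -/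
theorem pmf_sub_le_mul_ratio_pow (ps : List ℝ) (hps : ∀ p ∈ ps, 0 ≤ p ∧ p ≤ 1) {x : ℕ} (hx : 0 < pmf ps x) :
    ∀ j, j ≤ x → pmf ps (x - j) ≤ pmf ps x * (pmf ps (x - 1) / pmf ps x) ^ j := by
  have hlc := isLogConcaveSeq_pmf ps hps
  have hq0 := pmf_nonneg ps hps
  intro j
  induction j with
  | zero => intro _; simp
  | succ j ih =>
      intro hj
      have ih' := ih (by omega)
      have hratio0 : 0 ≤ pmf ps (x - 1) / pmf ps x := div_nonneg (hq0 _) hx.le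
      -- `q(x−j−1)·q(x) ≤ q(x−j)·q(x−1)` (ratio monotonicity with `i = x−j−1 ≤ x−1`)
      have hstep : pmf ps (x - (j + 1)) * pmf ps x ≤ pmf ps (x - j) * pmf ps (x - 1) := by
        have h := hlc.mul_succ_le (show x - (j + 1) ≤ x - 1 by omega)
        rwa [show x - (j + 1) + 1 = x - j by omega, show x - 1 + 1 = x by omega] at h
      have hle : pmf ps (x - (j + 1)) ≤ pmf ps (x - j) * (pmf ps (x - 1) / pmf ps x) := by
        rw [mul_div_assoc', le_div_iff₀ hx]; exact hstep
      calc pmf ps (x - (j + 1)) ≤ pmf ps (x - j) * (pmf ps (x - 1) / pmf ps x) := hle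
        _ ≤ pmf ps x * (pmf ps (x - 1) / pmf ps x) ^ j * (pmf ps (x - 1) / pmf ps x) :=
            mul_le_mul_of_nonneg_right ih' hratio0
        _ = pmf ps x * (pmf ps (x - 1) / pmf ps x) ^ (j + 1) := by rw [pow_succ]; ring

/-- **Right geometric envelope of a log-concave law**: for `q(x) > 0`, `q(x + j) ≤ q(x)·(q(x+1)/q(x))^j` for all `j`
(the ratios `q(y+1)/q(y)` are non-increasing). [cite: Karlin1968, Ch. 8 §1] -/
theorem pmf_add_le_mul_ratio_pow (ps : List ℝ) (hps : ∀ p ∈ ps, 0 ≤ p ∧ p ≤ 1) {x : ℕ} (hx : 0 < pmf ps x) :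
    ∀ j, pmf ps (x + j) ≤ pmf ps x * (pmf ps (x + 1) / pmf ps x) ^ j := by
  have hlc := isLogConcaveSeq_pmf ps hps
  have hq0 := pmf_nonneg ps hps
  intro j
  induction j with
  | zero => simp
  | succ j ih =>
      have hratio0 : 0 ≤ pmf ps (x + 1) / pmf ps x := div_nonneg (hq0 _) hx.le
      -- `q(x)·q(x+j+1) ≤ q(x+1)·q(x+j)` (ratio monotonicity with `i = x ≤ x+j`)
      have hstep : pmf ps x * pmf ps (x + j + 1) ≤ pmf ps (x + 1) * pmf ps (x + j) := hlc.mul_succ_le (by omega)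
      have hle : pmf ps (x + (j + 1)) ≤ pmf ps (x + j) * (pmf ps (x + 1) / pmf ps x) := by
        rw [mul_div_assoc', le_div_iff₀ hx, ← add_assoc]; linarith
      calc pmf ps (x + (j + 1)) ≤ pmf ps (x + j) * (pmf ps (x + 1) / pmf ps x) := hle
        _ ≤ pmf ps x * (pmf ps (x + 1) / pmf ps x) ^ j * (pmf ps (x + 1) / pmf ps x) :=
            mul_le_mul_of_nonneg_right ih hratio0
        _ = pmf ps x * (pmf ps (x + 1) / pmf ps x) ^ (j + 1) := by rw [pow_succ]; ring

/-- **The window lower bound**: for `q(x) > 0`, any point `m` with `|m − x| ≤ L` (e.g. a maximiser of `q`) and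
`ρ_x := max(q(x−1)/q(x), q(x+1)/q(x))` the larger neighbour ratio at `x`: `q(m) ≤ q(x)·max(1,ρ_x)^L`; with a maximiser `m`
and §3 this is the lower bound `q(x) ≥ (3/(8(2√V+1)))·max(1,ρ_x)^{−L}`. [cite: Karlin1968, Ch. 8 §1] [cite: Durrett2019, Thm. 1.6.4] -/
theorem max_pmf_le_mul_pow (ps : List ℝ) (hps : ∀ p ∈ ps, 0 ≤ p ∧ p ≤ 1) {x m L : ℕ} (hx : 0 < pmf ps x)
    (hL : m ≤ x + L ∧ x ≤ m + L) :
    pmf ps m ≤ pmf ps x * (max 1 (max (pmf ps (x - 1) / pmf ps x) (pmf ps (x + 1) / pmf ps x))) ^ L := by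
  set ρ := max 1 (max (pmf ps (x - 1) / pmf ps x) (pmf ps (x + 1) / pmf ps x)) with hρ
  have hρ1 : 1 ≤ ρ := le_max_left _ _
  have hmono : ∀ {a b : ℕ}, a ≤ b → ρ ^ a ≤ ρ ^ b := fun h => pow_le_pow_right₀ hρ1 h
  rcases le_or_gt m x with hmx | hxm
  · -- `m = x − j`, `j ≤ L`
    obtain ⟨j, hj⟩ : ∃ j, j ≤ x ∧ m = x - j := ⟨x - m, by omega, by omega⟩
    rw [hj.2]
    calc pmf ps (x - j) ≤ pmf ps x * (pmf ps (x - 1) / pmf ps x) ^ j := pmf_sub_le_mul_ratio_pow ps hps hx j hj.1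
      _ ≤ pmf ps x * ρ ^ j := mul_le_mul_of_nonneg_left
          (pow_le_pow_left₀ (div_nonneg (pmf_nonneg ps hps _) hx.le) ((le_max_left _ _).trans (le_max_right _ _)) j) hx.le
      _ ≤ pmf ps x * ρ ^ L := mul_le_mul_of_nonneg_left (hmono (by omega)) hx.le
  · obtain ⟨j, rfl⟩ := Nat.exists_eq_add_of_lt hxm
    calc pmf ps (x + j + 1) = pmf ps (x + (j + 1)) := by rw [add_assoc]
      _ ≤ pmf ps x * (pmf ps (x + 1) / pmf ps x) ^ (j + 1) := pmf_add_le_mul_ratio_pow ps hps hx (j + 1)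
      _ ≤ pmf ps x * ρ ^ (j + 1) := mul_le_mul_of_nonneg_left
          (pow_le_pow_left₀ (div_nonneg (pmf_nonneg ps hps _) hx.le) ((le_max_right _ _).trans (le_max_right _ _)) _) hx.le
      _ ≤ pmf ps x * ρ ^ L := mul_le_mul_of_nonneg_left (hmono (by omega)) hx.le

/-! ## §11 Every maximiser of a hypergeometric law is within `2` of its mean -/

/-- **Maximisers of a hypergeometric law sit within `2` of the mean** (in the currency `H_{b,d,r}`, mean `μ = rb/(b+d)`): if
`coeff_m(H_{b,d,r}) ≥ coeff_i(H_{b,d,r})` for all `i`, then `|m − μ| ≤ 2`. From the explicit ratio (§9): at a maximiser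
`λ(m) ≥ 1 ≥ λ(m−1)`, i.e. `x* − 1 ≤ m ≤ x* + 1` with `x* = ((b+1)(r+1) − (b+d+2))/(b+d+2) ∈ (μ − 1, μ]`; the boundary cases are direct.
[cite: VatutinMikhailov1983, §2] [cite: Karlin1968, Ch. 8 §1] -/
theorem hyperGen_argmax_near_mean {b d r m : ℕ} (hr : r ≤ b + d) (hN : 0 < b + d)
    (hm : ∀ i, (hyperGen b d r).coeff i ≤ (hyperGen b d r).coeff m) :
    |(m : ℝ) - (r : ℝ) * b / ((b : ℝ) + d)| ≤ 2 := by
  have hNR : (0 : ℝ) < (b : ℝ) + d := by exact_mod_cast hN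
  -- the maximiser carries positive mass (total mass `C(b+d,r) > 0` sits on `[0,r]`)
  have hpos : 0 < (hyperGen b d r).coeff m := by
    by_contra h
    have hle : ∀ i, (hyperGen b d r).coeff i ≤ 0 := fun i => (hm i).trans (not_lt.1 h)
    have h1 : (hyperGen b d r).eval 1 ≤ 0 := by
      rw [eval_eq_sum_range, sum_range_succ_comm]
      simp only [one_pow, mul_one]
      have := hle (hyperGen b d r).natDegree
      linarith [sum_nonpos (fun i (_ : i ∈ range (hyperGen b d r).natDegree) => hle i)]
    rw [eval_one_hyperGen] at h1
    have : (0 : ℝ) < (((b + d).choose r : ℕ) : ℝ) := by exact_mod_cast Nat.choose_pos hr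
    linarith
  -- hence `m ≤ r`, `m ≤ b`, `r − m ≤ d`
  have hcoefm := coeff_hyperGen b d r m
  have hmr : m ≤ r := by
    by_contra h; rw [hcoefm, if_neg h] at hpos; exact lt_irrefl _ hpos
  rw [if_pos hmr] at hcoefm
  have hmb : m ≤ b := by
    by_contra h
    rw [hcoefm, Nat.choose_eq_zero_of_lt (show b < m by omega), Nat.zero_mul, Nat.cast_zero] at hpos
    exact lt_irrefl _ hpos
  have hmd : r - m ≤ d := by
    by_contra h
    rw [hcoefm, Nat.choose_eq_zero_of_lt (show d < r - m by omega), Nat.mul_zero, Nat.cast_zero] at hpos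
    exact lt_irrefl _ hpos
  -- real-number bookkeeping
  have hbR : (m : ℝ) ≤ b := by exact_mod_cast hmb
  have hrR : (m : ℝ) ≤ r := by exact_mod_cast hmr
  have hdR : (r : ℝ) - m ≤ d := by
    have : ((r - m : ℕ) : ℝ) ≤ d := by exact_mod_cast hmd
    rwa [Nat.cast_sub hmr] at this
  have hrN : (r : ℝ) ≤ (b : ℝ) + d := by exact_mod_cast hr
  have hb0 : (0 : ℝ) ≤ b := Nat.cast_nonneg _
  have hr0 : (0 : ℝ) ≤ r := Nat.cast_nonneg _
  have hd0 : (0 : ℝ) ≤ d := Nat.cast_nonneg _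
  have hm0 : (0 : ℝ) ≤ m := Nat.cast_nonneg _
  have hμr : (r : ℝ) * b / ((b : ℝ) + d) ≤ r := by rw [div_le_iff₀ hNR]; nlinarith
  have hμb : (r : ℝ) * b / ((b : ℝ) + d) ≤ b := by rw [div_le_iff₀ hNR]; nlinarith
  have hμge : (r : ℝ) - d ≤ (r : ℝ) * b / ((b : ℝ) + d) := by rw [le_div_iff₀ hNR]; nlinarith
  have hμ0 : 0 ≤ (r : ℝ) * b / ((b : ℝ) + d) := by positivity
  rw [abs_le]
  constructor
  · -- LOWER bound `m ≥ μ − 2`: either `m + 1 > min(b,r)` (then `m ≥ μ − 1`) or the ratio at `m` is `≥ 1`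
    by_cases hedge : m + 1 ≤ b ∧ m + 1 ≤ r
    · have hxd : r ≤ d + m := by omega
      have hrat := coeff_hyperGen_div_coeff_succ hedge.1 hedge.2 hxd
      have hpos1 : 0 < (hyperGen b d r).coeff (m + 1) := by
        rw [coeff_hyperGen, if_pos hedge.2]
        exact_mod_cast Nat.mul_pos (Nat.choose_pos hedge.1) (Nat.choose_pos (by omega))
      have h1b : (m : ℝ) + 1 ≤ b := by exact_mod_cast hedge.1
      have h1r : (m : ℝ) + 1 ≤ r := by exact_mod_cast hedge.2
      have hden : (0 : ℝ) < ((b : ℝ) - m) * ((r : ℝ) - m) := mul_pos (by linarith) (by linarith)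
      have hge1 : ((b : ℝ) - m) * ((r : ℝ) - m) ≤ ((m : ℝ) + 1) * ((d : ℝ) - r + m + 1) := by
        have h : 1 ≤ ((m : ℝ) + 1) * ((d : ℝ) - r + m + 1) / (((b : ℝ) - m) * ((r : ℝ) - m)) := by
          rw [← hrat, le_div_iff₀ hpos1, one_mul]; exact hm (m + 1)
        rwa [le_div_iff₀ hden, one_mul] at h
      -- `(b−m)(r−m) ≤ (m+1)(d−r+m+1)` ⟹ `rb ≤ (m+2)(b+d)`
      have key : (r : ℝ) * b ≤ ((m : ℝ) + 2) * ((b : ℝ) + d) := by nlinarith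
      have : (r : ℝ) * b / ((b : ℝ) + d) ≤ (m : ℝ) + 2 := by rw [div_le_iff₀ hNR]; exact key
      linarith
    · rw [not_and_or, not_le, not_le] at hedge
      rcases hedge with h | h
      · have : (b : ℝ) < m + 1 := by exact_mod_cast h
        linarith
      · have : (r : ℝ) < m + 1 := by exact_mod_cast h
        linarith
  · -- UPPER bound `m ≤ μ + 2`: `m = 0`, or `r − (m−1) > d` (then `m ≤ r − d ≤ μ`), or the ratio at `m−1` is `≤ 1`
    rcases Nat.eq_zero_or_pos m with hm0' | hmpos
    · subst hm0'; simp only [Nat.cast_zero]; linarith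
    · by_cases hedge : r ≤ d + (m - 1)
      · have h1 : m - 1 + 1 ≤ b := by omega
        have h2 : m - 1 + 1 ≤ r := by omega
        have hrat := coeff_hyperGen_div_coeff_succ h1 h2 hedge
        rw [show m - 1 + 1 = m by omega] at hrat
        have hm1 : ((m - 1 : ℕ) : ℝ) = (m : ℝ) - 1 := by
          rw [Nat.cast_sub (by omega)]; simp
        have hden : (0 : ℝ) < ((b : ℝ) - ((m : ℝ) - 1)) * ((r : ℝ) - ((m : ℝ) - 1)) :=
          mul_pos (by linarith) (by linarith)
        have hle1 : ((m : ℝ) - 1 + 1) * ((d : ℝ) - r + ((m : ℝ) - 1) + 1) ≤ ((b : ℝ) - ((m : ℝ) - 1)) * ((r : ℝ) - ((m : ℝ) - 1)) := by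
          have h : (((m - 1 : ℕ) : ℝ) + 1) * ((d : ℝ) - r + ((m - 1 : ℕ) : ℝ) + 1) /
              (((b : ℝ) - ((m - 1 : ℕ) : ℝ)) * ((r : ℝ) - ((m - 1 : ℕ) : ℝ))) ≤ 1 := by
            rw [← hrat, div_le_one hpos]; exact hm (m - 1)
          rw [hm1] at h
          rwa [div_le_iff₀ hden, one_mul] at h
        have hm1R : (1 : ℝ) ≤ m := by exact_mod_cast hmpos
        -- `m(d−r+m) ≤ (b−m+1)(r−m+1)` ⟹ `(m−2)(b+d) ≤ rb`
        have key : ((m : ℝ) - 2) * ((b : ℝ) + d) ≤ (r : ℝ) * b := by nlinarith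
        have : (m : ℝ) - 2 ≤ (r : ℝ) * b / ((b : ℝ) + d) := by rw [le_div_iff₀ hNR]; exact key
        linarith
      · -- `r − (m−1) > d` ⟹ `m ≤ r − d ≤ μ`
        have : (m : ℝ) ≤ (r : ℝ) - d := by
          have h : m + d ≤ r := by omega
          have : ((m + d : ℕ) : ℝ) ≤ r := by exact_mod_cast h
          push_cast at this; linarith
        linarith

end PoissonBinomial

end Literature.Probability.Distributions
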